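/-
COR-CM (cell pub-hodgecm2, stage 2 of the Hodge ladder) — count-neutral census lane of the binder seat b23 (gen 56, prover-pub-hodgecm2-b23-g56-0;
claim «INDEX-TWO CYCLIC — THE MIXED TWISTS», HOME/INBOX.md l.26438): FIELD LEVEL of `Census/IndexTwoCyclicMixed{Structure,Octic,Law}.lean`
through the INT2-GEN socket (`FaceTransfer.isLeast_card_faces_hgen_of_intrinsic`) and gen 49ʼs Aut-datum
(`FaceIndexTwoCyclic.exists_datum_of_aut_involution`) BY NAME.  Theorems only; no definition, no `decide`, no certificate, no named fact, no `sorry`;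
`Interfaces.lean` (C1), every E term, B01, `Transposition/*`, `PortJoin/*`, `D2Bridge/*` untouched.
HONEST FRAMING: `HC_CM` is NOT proved, here or anywhere in the tree; the `hodgeConjectureFor_…` reading below is CONDITIONAL on face periods.
T5: n/a-class (hypothesis binders: Galois CM field, the index-two cyclic Galois datum / the automorphisms `u₀, w₀`, the case hypothesis; checker: self).
-/
import Summits.HodgeConjecture.CorCM.Census.IndexTwoCyclicMixedLaw
import HarnessLib

/-!
# Faces of Galois CM fields with group `ℤ/2n ⋊_r ℤ/2`: the mixed twists up to the octic level

For a Galois CM field `F` whose Galois translates carry a split index-two cyclic datum (`GalT F ≅ ℤ/2n ⋊_r ℤ/2`, complex conjugation `uⁿ`,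
`n` even), write `v = u^{r+1} = (w·u)²`.  Seat b23 gen 49/50 gave EXACTLY `φ₂(F)` generating faces when `conjT ∈ ⟨v⟩` and at 2-power level; gen 48
the dihedral case `v = 1`.  This file adds the MIXED twists at the octic level (`conjT ∉ ⟨v⟩`, `v ≠ 1`, `n = 2·orderOf v`:
`Gal ≅ D₄ × C_j`, `F` = an octic dihedral CM field (conjugation `= r²`) times a cyclic totally real field of odd degree `j`):

* `isLeast_card_faces_hgen_of_octic_level`, `…_of_le_octic` (datum forms), `…_of_aut_octic_level` (from `u₀, w₀ ∈ Aut(F)` alone: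
  `[F:ℚ] = 4n`, `u₀` of order `2n`, `u₀ⁿ` = complex conjugation at `σ₀`, an involution `w₀ ∉ ⟨u₀⟩`, `u₀ⁿ ∉ ⟨(w₀u₀)²⟩`, `(w₀u₀)² ≠ 1`,
  `n = 2·orderOf (w₀u₀)²`): **EXACTLY `φ₂(F)` generating faces**;
* `hodgeConjectureFor_of_le_octic_of_exists_facePeriod`: the CONDITIONAL HC reading for the slice (HC_CM is NOT proved).

## References
* [Pohlmann1968] H. Pohlmann, Algebraic cycles on abelian varieties of complex multiplication type, Ann. of Math. 88 (1968), Thm 1.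
* [Shimura1998] G. Shimura, Abelian Varieties with Complex Multiplication and Modular Functions, Princeton 1998, §6.2 Thm 3.
-/

open CategoryTheory NumberField NumberField.ComplexEmbedding
open Literature.AlgebraicGeometry Literature.AlgebraicGeometry.Motives Literature.AlgebraicGeometry.HodgeTheory
open Literature.AlgebraicGeometry.ComplexMultiplication Literature.AlgebraicGeometry.Milne1999
open Literature.NumberTheory.Automorphic
open Literature.NumberTheory.Automorphic.PicardCM
open Summit.HodgeConjecture.CorCM.Domination

namespace Summit.HodgeConjecture.CorCM.FaceIndexTwoCyclic

open Summit.HodgeConjecture.CorCM.Prior.AllgGroup.RfwfAllgGroup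
open Summit.HodgeConjecture.CorCM.Census.BlockParity
open Summit.HodgeConjecture.CorCM.Census.Coinvariant
open Summit.HodgeConjecture.CorCM.Census
open Summit.HodgeConjecture.CorCM.FaceCensus.OddSlice (galTOfAut galTOfAut_mul galTOfAut_conjAut)

noncomputable section

variable {F : Type} [Field F] [NumberField F] {n : ℕ} [NeZero n]

/-- Complex conjugation is central in `GalT F` along the datum (file-local). [folklore] -/
private theorem conjT_comm₃ (D : IndexTwoCyclic.Datum (GalT F) conjT n) (y : GalT F) : y * conjT = conjT * y := by
  have h := D.comm_pow_n y
  rwa [D.hun] at h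

/-- **EXACTLY `φ₂(F)` GENERATING FACES AT THE OCTIC MIXED LEVEL** (datum form): `conjT ∉ ⟨u^{r+1}⟩`, `u^{r+1} ≠ 1`, `n = 2·orderOf u^{r+1}`
(`Gal(F/ℚ) ≅ D₄ × C_j`, conjugation `= r²`). [folklore] -/
theorem isLeast_card_faces_hgen_of_octic_level [IsCMField F] [IsGalois ℚ F] (D : IndexTwoCyclic.Datum (GalT F) conjT n)
    (h : (conjT : GalT F) ∉ Subgroup.zpowers (D.u ^ (D.r + 1))) (hv : D.u ^ (D.r + 1) ≠ 1) (hn : n = 2 * orderOf (D.u ^ (D.r + 1)))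
    (σ₀ : F →+* ℂ) :
    IsLeast {m : ℕ | ∃ 𝒮 : Finset (Face F), 𝒮.card = m ∧
      ∀ f : Face F, lefChar f.corner (fun _ => ({σ₀} : Finset (F →+* ℂ))) ∈ AddSubgroup.closure
        {a : Asym F | ∃ g ∈ (𝒮 : Set (Face F)), ∃ σ : F →+* ℂ, a = lefChar g.corner (fun _ => ({σ} : Finset (F →+* ℂ)))}}
      (fibreTwo (conjT : GalT F) conjT_mul_self) := by
  refine FaceTransfer.isLeast_card_faces_hgen_of_intrinsic _ ?_ (fun S₀ hS₀ hS => ?_) σ₀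
  · obtain ⟨S, hS, hcard, hgen⟩ :=
      (IndexTwoCyclic.isLeast_card_gfaces_generate_fibreTwo_of_octic_level D conjT_mul_self conjT_ne_one h hv hn).1
    exact ⟨S, hS, hcard.le, hgen⟩
  · exact fibreTwo_le_card conjT conjT_mul_self (conjT_comm₃ D) S₀ (Submodule.span ℤ (pairSet conjT)) le_rfl hS₀
      (fun y hy => hS (gfaceSet_subset_hodgeSpan conjT conjT_mul_self hy))

/-- **EXACTLY `φ₂(F)` GENERATING FACES UP TO THE OCTIC LEVEL** (datum form, `n` even): twist side, dihedral side, or mixed side with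
`n = 2·orderOf u^{r+1}`. [folklore] -/
theorem isLeast_card_faces_hgen_of_le_octic [IsCMField F] [IsGalois ℚ F] (D : IndexTwoCyclic.Datum (GalT F) conjT n) (hn : Even n)
    (hoct : (conjT : GalT F) ∉ Subgroup.zpowers (D.u ^ (D.r + 1)) → D.u ^ (D.r + 1) ≠ 1 → n = 2 * orderOf (D.u ^ (D.r + 1)))
    (σ₀ : F →+* ℂ) :
    IsLeast {m : ℕ | ∃ 𝒮 : Finset (Face F), 𝒮.card = m ∧
      ∀ f : Face F, lefChar f.corner (fun _ => ({σ₀} : Finset (F →+* ℂ))) ∈ AddSubgroup.closure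
        {a : Asym F | ∃ g ∈ (𝒮 : Set (Face F)), ∃ σ : F →+* ℂ, a = lefChar g.corner (fun _ => ({σ} : Finset (F →+* ℂ)))}}
      (fibreTwo (conjT : GalT F) conjT_mul_self) := by
  refine FaceTransfer.isLeast_card_faces_hgen_of_intrinsic _ ?_ (fun S₀ hS₀ hS => ?_) σ₀
  · obtain ⟨S, hS, hcard, hgen⟩ :=
      (IndexTwoCyclic.isLeast_card_gfaces_generate_fibreTwo_of_le_octic D conjT_mul_self conjT_ne_one hn hoct).1
    exact ⟨S, hS, hcard.le, hgen⟩
  · exact fibreTwo_le_card conjT conjT_mul_self (conjT_comm₃ D) S₀ (Submodule.span ℤ (pairSet conjT)) le_rfl hS₀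
      (fun y hy => hS (gfaceSet_subset_hodgeSpan conjT conjT_mul_self hy))

/-- **… from `u₀, w₀ ∈ Aut(F)` alone, octic mixed level**: `[F:ℚ] = 4n`, `u₀` of order `2n` with `u₀ⁿ` inducing complex conjugation at `σ₀`,
an involution `w₀ ∉ ⟨u₀⟩`, `u₀ⁿ ∉ ⟨(w₀u₀)²⟩`, `(w₀u₀)² ≠ 1`, `n = 2·orderOf (w₀u₀)²` — EXACTLY `φ₂(F)` generating faces (e.g. the compositum of
an octic dihedral CM field with conjugation `r²` and a cyclic totally real field of odd degree coprime to nothing in particular). [folklore] -/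
theorem isLeast_card_faces_hgen_of_aut_octic_level [IsCMField F] [IsGalois ℚ F] (σ₀ : F →+* ℂ) (u₀ w₀ : F ≃ₐ[ℚ] F)
    (hord : orderOf u₀ = 2 * n) (hcσ : σ₀.comp ((u₀ ^ n : F ≃ₐ[ℚ] F) : F →+* F) = conjugate σ₀) (hw : w₀ ∉ Subgroup.zpowers u₀)
    (hww : w₀ * w₀ = 1) (hdeg : Module.finrank ℚ F = 4 * n) (h : u₀ ^ n ∉ Subgroup.zpowers ((w₀ * u₀) ^ 2)) (hv : (w₀ * u₀) ^ 2 ≠ 1)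
    (hn : n = 2 * orderOf ((w₀ * u₀) ^ 2)) :
    IsLeast {m : ℕ | ∃ 𝒮 : Finset (Face F), 𝒮.card = m ∧
      ∀ f : Face F, lefChar f.corner (fun _ => ({σ₀} : Finset (F →+* ℂ))) ∈ AddSubgroup.closure
        {a : Asym F | ∃ g ∈ (𝒮 : Set (Face F)), ∃ σ : F →+* ℂ, a = lefChar g.corner (fun _ => ({σ} : Finset (F →+* ℂ)))}}
      (fibreTwo (conjT : GalT F) conjT_mul_self) := by
  obtain ⟨D, hDu, hDw, -⟩ := exists_datum_of_aut_involution σ₀ u₀ w₀ hord hcσ hw hww hdeg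
  set e : (F ≃ₐ[ℚ] F) ≃* GalT F := MulEquiv.mk' (galTOfAut σ₀) (galTOfAut_mul σ₀) with he
  have he_apply : ∀ x, e x = galTOfAut σ₀ x := fun x => rfl
  have hun : e (u₀ ^ n) = conjT := by rw [he_apply]; exact galTOfAut_conjAut σ₀ hcσ
  have hsq : (D.w * D.u) ^ 2 = e ((w₀ * u₀) ^ 2) := by rw [map_pow, map_mul, he_apply, he_apply, hDu, hDw]
  have htw : D.u ^ (D.r + 1) = e ((w₀ * u₀) ^ 2) := by rw [← IndexTwoCyclic.w_mul_u_sq D, hsq]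
  have h' : (conjT : GalT F) ∉ Subgroup.zpowers (D.u ^ (D.r + 1)) := by
    intro hc
    rw [htw, ← hun] at hc
    obtain ⟨k, hk⟩ := Subgroup.mem_zpowers_iff.mp hc
    rw [← map_zpow, e.apply_eq_iff_eq] at hk
    exact h (Subgroup.mem_zpowers_iff.mpr ⟨k, hk⟩)
  have hv' : D.u ^ (D.r + 1) ≠ 1 := by
    rw [htw, ne_eq, map_eq_one_iff e e.injective]
    exact hv
  have hn' : n = 2 * orderOf (D.u ^ (D.r + 1)) := by
    rw [htw, MulEquiv.orderOf_eq]
    exact hn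
  exact isLeast_card_faces_hgen_of_octic_level D h' hv' hn' σ₀

/-- **HC for the slice of a Galois CM field with group `ℤ/2n ⋊_r ℤ/2` up to the octic level, from `φ₂` face periods** (INT2-GEN socket BY NAME;
`n ≥ 2` even; CONDITIONAL on the periods — `HC_CM` is NOT proved): there is a face set `𝒮` with `|𝒮| = φ₂(K)` (none fewer can satisfy the
generation binder) such that, if every face of `𝒮` has a non-vanishing period on the universe of record, the Hodge conjecture holds for every
abelian variety dominated by a product of CM abelian varieties with CM by subfields of `K`.
[cite: Shimura1998, §6.2 Theorem 3 and §6.1 Corollary of Theorem 2 (pp. 41–43)] [cite: Pohlmann1968, Thm. 1]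
[cite: Milne1999LefschetzClasses, Thm. 3.2 and Cor. 4.5] [cite: MumfordAV1970, §19 Thm. 1 and p. 169] -/
theorem hodgeConjectureFor_of_le_octic_of_exists_facePeriod (K : CMField) [hGal : IsGalois ℚ K]
    (D : IndexTwoCyclic.Datum (GalT K) conjT n) (hn : Even n)
    (hoct : (conjT : GalT K) ∉ Subgroup.zpowers (D.u ^ (D.r + 1)) → D.u ^ (D.r + 1) ≠ 1 → n = 2 * orderOf (D.u ^ (D.r + 1)))
    (h2 : 2 ≤ n) (σ₀ : (K : Type) →+* ℂ) :
    ∃ 𝒮 : Finset (Face K), 𝒮.card = fibreTwo (conjT : GalT K) conjT_mul_self ∧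
      ((∀ f ∈ 𝒮, ∃ ι₁ : K →+* ℂ, f.Admissible ι₁ ∧ ∃ (V : HermSpace3 K ι₁) (σ : K →+* ℂ),
        (Model.picardCMUniverse exists_isReal_hodgeModel_holds hodgePQ_independent_of_hodgeModel_holds
          BallQuotient.ballQuotientUniformised_holds cmAbelianVarietyRealised_holds).PeriodNV ι₁ V K f.psi σ) →
      ∀ {P B : AbelianVariety ℂ}, AbelianVariety.IsProductOf (fun B : AbelianVariety ℂ =>
        ∃ (E : Type) (_ : Field E) (_ : NumberField E) (_ : IsCMField E) (_ : E →+* (K : Type)) (Φ : CMType E)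
          (ι : 𝓞 E →+* End B) (ϑ : E →+* Module.End ℂ (complexBetti B.X 1)),
          IsCMTypeRealisation Φ B ι ϑ) P →
      AVDominatedBy B P → HodgeConjectureFor B.dim B.X) := by
  obtain ⟨⟨𝒮, hcard, hgen⟩, -⟩ := isLeast_card_faces_hgen_of_le_octic (F := K) D hn hoct σ₀
  refine ⟨𝒮, hcard, fun h P B hP hB => ?_⟩
  have h6 : 6 ≤ Module.finrank ℚ K := by
    have h4 := four_mul_eq_finrank (F := K) D
    omega
  exact hodgeConjectureFor_of_avDominatedBy_isProductOf_of_exists_facePeriod_on K h6 (𝒮 : Set (Face K)) σ₀ hgen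
    (fun f hf => h f (Finset.mem_coe.mp hf)) hP hB

/-! ## Appendix (same seat, same session): the octic mixed level read from orders of automorphisms -/

/-- **EXACTLY `φ₂(F)` GENERATING FACES FROM ORDERS OF AUTOMORPHISMS ALONE** (`Gal ≅ D₄ × C_j`): `[F:ℚ] = 8j` with `j` odd `≥ 3`, `u₀ ∈ Aut(F)` of
order `4j` with `u₀^{2j}` inducing complex conjugation at `σ₀`, an involution `w₀ ∉ ⟨u₀⟩`, and `orderOf (w₀·u₀)² = j` — e.g. the compositum of an
octic dihedral CM field (conjugation `= r²`) with a cyclic totally real field of odd degree `j`. [folklore] -/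
theorem isLeast_card_faces_hgen_of_aut_orderOf_sq [IsCMField F] [IsGalois ℚ F] {j : ℕ} (σ₀ : F →+* ℂ) (u₀ w₀ : F ≃ₐ[ℚ] F)
    (hord : orderOf u₀ = 2 * n) (hcσ : σ₀.comp ((u₀ ^ n : F ≃ₐ[ℚ] F) : F →+* F) = conjugate σ₀) (hw : w₀ ∉ Subgroup.zpowers u₀)
    (hww : w₀ * w₀ = 1) (hdeg : Module.finrank ℚ F = 4 * n) (hn : n = 2 * j) (hj : Odd j) (h3 : 3 ≤ j) (hsq : orderOf ((w₀ * u₀) ^ 2) = j) :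
    IsLeast {m : ℕ | ∃ 𝒮 : Finset (Face F), 𝒮.card = m ∧
      ∀ f : Face F, lefChar f.corner (fun _ => ({σ₀} : Finset (F →+* ℂ))) ∈ AddSubgroup.closure
        {a : Asym F | ∃ g ∈ (𝒮 : Set (Face F)), ∃ σ : F →+* ℂ, a = lefChar g.corner (fun _ => ({σ} : Finset (F →+* ℂ)))}}
      (fibreTwo (conjT : GalT F) conjT_mul_self) := by
  -- `u₀ⁿ` has order `2`: it is not the identity (it induces complex conjugation on the CM field) and squares to `1`
  have hn1 : u₀ ^ n ≠ 1 := fun e => by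
    have h2n : orderOf u₀ ∣ n := orderOf_dvd_of_pow_eq_one e
    rw [hord] at h2n
    have hn0 : 0 < n := Nat.pos_of_ne_zero (NeZero.ne n)
    exact absurd (Nat.le_of_dvd hn0 h2n) (by omega)
  have hu2 : (u₀ ^ n) ^ 2 = 1 := by rw [← pow_mul, mul_comm, ← hord, pow_orderOf_eq_one]
  have hordc : orderOf (u₀ ^ n) = 2 := orderOf_eq_prime hu2 hn1
  have h : u₀ ^ n ∉ Subgroup.zpowers ((w₀ * u₀) ^ 2) := fun hc => by
    have hdvd := orderOf_dvd_of_mem_zpowers hc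
    rw [hordc, hsq] at hdvd
    exact hj.not_two_dvd_nat hdvd
  have hv : (w₀ * u₀) ^ 2 ≠ 1 := fun e => by
    have h1 : orderOf ((w₀ * u₀) ^ 2) = 1 := by rw [e, orderOf_one]
    omega
  exact isLeast_card_faces_hgen_of_aut_octic_level σ₀ u₀ w₀ hord hcσ hw hww hdeg h hv (by rw [hsq]; exact hn)

end

end Summit.HodgeConjecture.CorCM.FaceIndexTwoCyclic
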